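import Summits.Schanuel.Schanuel.Theorems.RigidCoreSparsityTwoDefs
import Summits.Schanuel.Schanuel.Theorems.RigidCoreSparsityTwoAtomsOfCrux
import Summits.Schanuel.Schanuel.Theorems.RigidCoreSparsityTwoReduction
import Summits.Schanuel.Schanuel.Theorems.RigidCoreSparsityTwoSplitLemmas
import Summits.Schanuel.Schanuel.Theorems.RigidCoreSparsityTwoSplit
import Summits.Schanuel.Schanuel.Theorems.RigidCoreSparsityTwoCuspEscapeAlg
import Summits.Schanuel.Schanuel.Theorems.RigidCoreSparsityTwoDeepCuspFinite
import Literature.NumberTheory.Transcendental.TrdegZariskiDim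

/-!
# `RigidCore.SparsityTwo` ⟺ the three named atoms (line `cusp-germ-schneider-sparsity`, lead c3)

Crux `Summit.Schanuel.Schanuel.Theses.RigidCore.SparsityTwo` (item stmt-Schanuel-0971).  Over the definitions module
`RigidCoreSparsityTwoDefs` (`CuspDatum`, `WildCuspAtom`, `InhomogeneousCuspAtom`, `LinearCuspAtom`) this file lands
* the BRIDGES `stub_wildCuspAtom_of_named`, `stub_inhomogeneousCuspAtom_of_named`, `stub_linearCuspAtom_of_named`: each named
  atom implies the registered stub statement VERBATIM (bundle the 12 binders and 33 shared hypotheses into a `CuspDatum`;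
  definitional), so a future proof of a named atom lands as the stub;
* the GLUE `sparsityTwo_of_namedAtoms : WildCuspAtom → InhomogeneousCuspAtom → LinearCuspAtom → SparsityTwo` — the composition
  `sparsityTwo_of_atoms_of_parts` (`RigidCoreSparsityTwoReduction`, p112413) fed BY NAME with the landed shifted Runge lemma
  `rationalJetShift_eventually_zero` (`…SplitLemmas`), the split `rayHits_finite_of_split'` (`…Split`), E⁺ `stub_cuspEscapeAlg`
  (`…CuspEscapeAlg`), the deep pocket `stub_deepCuspFinite` (`…DeepCuspFinite`) and the bridges;
* the CONVERSES `wildCuspAtom_of_sparsityTwo'` etc. (from `RigidCoreSparsityTwoAtomsOfCrux`, p108288) and the EQUIVALENCE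
  `sparsityTwo_iff_namedAtoms : SparsityTwo ↔ WildCuspAtom ∧ InhomogeneousCuspAtom ∧ LinearCuspAtom`;
* the upper calibration by name: `namedAtoms_of_schanuelRank_two : SchanuelRank 2 → WildCuspAtom ∧ …` (each atom is a theorem
  of SC(2), via `Literature.NumberTheory.Transcendental.sparsity_of_schanuelRank_two`, `TrdegZariskiDim.lean` p72297).
So the crux is, in the tree and sorry-free, EXACTLY the conjunction of three named W-free exact-coincidence statements at a
normalised cusp of a ℚ-curve, each open (Disproof §3a–c) and each SC(2)-implied.  No unproved facts; axioms standard.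
-/

set_option linter.dupNamespace false

namespace Summit.Schanuel.Schanuel.Cruxes.SparsityTwo.CuspGermSchneiderSparsity

open Filter Topology Complex Polynomial Literature.NumberTheory.Transcendental
open scoped Real

/-! ## The named atoms imply the registered stubs verbatim (so a proof of a named atom lands as the stub) -/

/-- `WildCuspAtom` implies the registered statement of `stub_wildCuspAtom` verbatim (bundle the binders into a
`CuspDatum`; definitional unfolding). -/
theorem stub_wildCuspAtom_of_named (hA : WildCuspAtom) :
    ∀ (e N₀ : ℕ) (A : Polynomial ℂ) (g ℓu ℓv T ℓ₀ ℓ₁ Φ₁ : ℂ → ℂ) (ρ r : ℝ),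
      let w : ℕ → ℂ := fun n => (((n : ℝ) ^ ((e : ℝ)⁻¹) : ℝ) : ℂ);
      let x : ℕ → Fin 2 → ℂ := fun n =>
        ![2 * ↑π * I * (n : ℂ) + ℓu (w n)⁻¹, 2 * ↑π * I * (A.eval (w n) + g (w n)⁻¹) + ℓv (w n)⁻¹];
      0 < e → 0 < ρ → 0 < r → AnalyticAt ℂ g 0 → g 0 = 0 → AnalyticAt ℂ ℓu 0 → AnalyticAt ℂ ℓv 0 →
      AnalyticAt ℂ T 0 → T 0 = 0 → AnalyticAt ℂ ℓ₀ 0 → AnalyticAt ℂ ℓ₁ 0 → AnalyticAt ℂ Φ₁ 0 →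
      (¬ ∃ P : MvPolynomial (Fin 2) ℂ, P ≠ 0 ∧
          ∀ᶠ z in 𝓝 (0 : ℂ), MvPolynomial.eval ![z, g z] P = 0) →
      (¬ ∃ (q : Polynomial ℚ) (c : ℂ), ∀ N : ℕ,
          A.eval (w N) = (q.map (algebraMap ℚ ℂ)).eval (N : ℂ) + c) →
      ((∀ k : ℕ, (A.coeff k).im = 0) ∧ ∀ᶠ u : ℝ in 𝓝[>] 0, (g (u : ℂ)).im = 0) →
      (∀ ε : ℝ, 0 < ε → ∃ᶠ X : ℕ in atTop,
        (Nat.card {N : ℕ | N ≤ X ∧ ∃ L : ℤ, A.eval (w N) + g (w N)⁻¹ = L} : ℝ) ≤ ε * Real.log X) →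
      (∀ σ : ℂ, 0 < ‖σ‖ → ‖σ‖ < ρ → 0 < ‖T σ‖ ∧ ‖T σ‖ < r ∧
        ((T σ) ^ e)⁻¹ = 2 * ↑π * I * σ⁻¹ ^ e + ℓu σ ∧
        Φ₁ (T σ) / (T σ) ^ N₀ = 2 * ↑π * I * (A.eval σ⁻¹ + g σ) + ℓv σ ∧
        ℓ₀ (T σ) = ℓu σ ∧ ℓ₁ (T σ) = ℓv σ) →
      (∃ W' : Set (Fin 2 ⊕ Fin 2 → ℂ), IsDefinedOver (⊥ : Subfield ℂ) W' ∧ zariskiDim ℂ W' < 2 ∧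
        ∀ t : ℂ, 0 < ‖t‖ → ‖t‖ < r →
          Sum.elim (![(t ^ e)⁻¹, Φ₁ t / t ^ N₀] : Fin 2 → ℂ)
            (![Complex.exp (ℓ₀ t), Complex.exp (ℓ₁ t)] : Fin 2 → ℂ) ∈ W') →
      (∃ R : MvPolynomial (Fin 2) ℚ, R ≠ 0 ∧ ∀ t : ℂ, 0 < ‖t‖ → ‖t‖ < r →
        MvPolynomial.aeval ![(t ^ e)⁻¹, Complex.exp (ℓ₀ t)] R = 0) →
      (∃ R : MvPolynomial (Fin 2) ℚ, R ≠ 0 ∧ ∀ t : ℂ, 0 < ‖t‖ → ‖t‖ < r →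
        MvPolynomial.aeval ![(t ^ e)⁻¹, Complex.exp (ℓ₁ t)] R = 0) →
      (∃ R : MvPolynomial (Fin 2) ℚ, R ≠ 0 ∧ ∀ t : ℂ, 0 < ‖t‖ → ‖t‖ < r →
        MvPolynomial.aeval ![(t ^ e)⁻¹, Φ₁ t / t ^ N₀] R = 0) →
      (∃ R : MvPolynomial (Fin 2) ℚ, R ≠ 0 ∧ ∀ t : ℂ, 0 < ‖t‖ → ‖t‖ < r →
        MvPolynomial.aeval ![Φ₁ t / t ^ N₀, Complex.exp (ℓ₀ t)] R = 0) →
      (∃ R : MvPolynomial (Fin 2) ℚ, R ≠ 0 ∧ ∀ t : ℂ, 0 < ‖t‖ → ‖t‖ < r →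
        MvPolynomial.aeval ![Φ₁ t / t ^ N₀, Complex.exp (ℓ₁ t)] R = 0) →
      (∃ R : MvPolynomial (Fin 2) ℚ, R ≠ 0 ∧ ∀ t : ℂ, 0 < ‖t‖ → ‖t‖ < r →
        MvPolynomial.aeval ![Complex.exp (ℓ₀ t), Complex.exp (ℓ₁ t)] R = 0) →
      (∀ n : ℕ, IsAlgebraic ℚ (iteratedDeriv n Φ₁ 0)) →
      IsAlgebraic ℚ (Complex.exp (ℓ₀ 0)) → IsAlgebraic ℚ (Complex.exp (ℓ₁ 0)) →
      (∀ n : ℕ, 0 < n → IsAlgebraic ℚ (iteratedDeriv n ℓ₀ 0)) →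
      (∀ n : ℕ, 0 < n → IsAlgebraic ℚ (iteratedDeriv n ℓ₁ 0)) →
      (¬ ∃ (β : ℂ) (G : ℂ → ℂ), AnalyticAt ℂ G 0 ∧
          ∀ t : ℂ, 0 < ‖t‖ → ‖t‖ < r → Φ₁ t / t ^ N₀ = β * (t ^ e)⁻¹ + G t) →
      (¬ ∀ᶠ t in 𝓝 (0 : ℂ), ℓ₀ t = ℓ₀ 0 ∧ ℓ₁ t = ℓ₁ 0) →
      Set.Finite {n : ℕ | LinearIndependent ℚ (x n) ∧ ∃ L : ℤ, A.eval (w n) + g (w n)⁻¹ = L} := by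
  intro e N₀ A g ℓu ℓv T ℓ₀ ℓ₁ Φ₁ ρ r w x he hρ hr hg hg0 hu hv hT hT0 h₀ h₁ hΦ₁ htr hrat hreal hlac hlink hW' hR₁ hR₂ hR₃ hR₄ hR₅
    hR₆ hΦ₁alg hy₀ hy₁ hℓ₀alg hℓ₁alg hnonlin hnc
  exact hA ⟨e, N₀, A, g, ℓu, ℓv, T, ℓ₀, ℓ₁, Φ₁, ρ, r, he, hρ, hr, hg, hg0, hu, hv, hT, hT0, h₀, h₁, hΦ₁, htr, hrat, hreal, hlac,
      hlink, hW', hR₁, hR₂, hR₃, hR₄, hR₅, hR₆, hΦ₁alg, hy₀, hy₁, hℓ₀alg, hℓ₁alg⟩ hnonlin hnc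

/-- `InhomogeneousCuspAtom` implies the registered statement of `stub_inhomogeneousCuspAtom` verbatim. -/
theorem stub_inhomogeneousCuspAtom_of_named (hA : InhomogeneousCuspAtom) :
    ∀ (e N₀ : ℕ) (A : Polynomial ℂ) (g ℓu ℓv T ℓ₀ ℓ₁ Φ₁ G : ℂ → ℂ) (ρ r : ℝ) (β : ℂ),
      let w : ℕ → ℂ := fun n => (((n : ℝ) ^ ((e : ℝ)⁻¹) : ℝ) : ℂ);
      let x : ℕ → Fin 2 → ℂ := fun n =>
        ![2 * ↑π * I * (n : ℂ) + ℓu (w n)⁻¹, 2 * ↑π * I * (A.eval (w n) + g (w n)⁻¹) + ℓv (w n)⁻¹];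
      0 < e → 0 < ρ → 0 < r → AnalyticAt ℂ g 0 → g 0 = 0 → AnalyticAt ℂ ℓu 0 → AnalyticAt ℂ ℓv 0 →
      AnalyticAt ℂ T 0 → T 0 = 0 → AnalyticAt ℂ ℓ₀ 0 → AnalyticAt ℂ ℓ₁ 0 → AnalyticAt ℂ Φ₁ 0 →
      (¬ ∃ P : MvPolynomial (Fin 2) ℂ, P ≠ 0 ∧
          ∀ᶠ z in 𝓝 (0 : ℂ), MvPolynomial.eval ![z, g z] P = 0) →
      (¬ ∃ (q : Polynomial ℚ) (c : ℂ), ∀ N : ℕ,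
          A.eval (w N) = (q.map (algebraMap ℚ ℂ)).eval (N : ℂ) + c) →
      ((∀ k : ℕ, (A.coeff k).im = 0) ∧ ∀ᶠ u : ℝ in 𝓝[>] 0, (g (u : ℂ)).im = 0) →
      (∀ ε : ℝ, 0 < ε → ∃ᶠ X : ℕ in atTop,
        (Nat.card {N : ℕ | N ≤ X ∧ ∃ L : ℤ, A.eval (w N) + g (w N)⁻¹ = L} : ℝ) ≤ ε * Real.log X) →
      (∀ σ : ℂ, 0 < ‖σ‖ → ‖σ‖ < ρ → 0 < ‖T σ‖ ∧ ‖T σ‖ < r ∧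
        ((T σ) ^ e)⁻¹ = 2 * ↑π * I * σ⁻¹ ^ e + ℓu σ ∧
        Φ₁ (T σ) / (T σ) ^ N₀ = 2 * ↑π * I * (A.eval σ⁻¹ + g σ) + ℓv σ ∧
        ℓ₀ (T σ) = ℓu σ ∧ ℓ₁ (T σ) = ℓv σ) →
      (∃ W' : Set (Fin 2 ⊕ Fin 2 → ℂ), IsDefinedOver (⊥ : Subfield ℂ) W' ∧ zariskiDim ℂ W' < 2 ∧
        ∀ t : ℂ, 0 < ‖t‖ → ‖t‖ < r →
          Sum.elim (![(t ^ e)⁻¹, Φ₁ t / t ^ N₀] : Fin 2 → ℂ)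
            (![Complex.exp (ℓ₀ t), Complex.exp (ℓ₁ t)] : Fin 2 → ℂ) ∈ W') →
      (∃ R : MvPolynomial (Fin 2) ℚ, R ≠ 0 ∧ ∀ t : ℂ, 0 < ‖t‖ → ‖t‖ < r →
        MvPolynomial.aeval ![(t ^ e)⁻¹, Complex.exp (ℓ₀ t)] R = 0) →
      (∃ R : MvPolynomial (Fin 2) ℚ, R ≠ 0 ∧ ∀ t : ℂ, 0 < ‖t‖ → ‖t‖ < r →
        MvPolynomial.aeval ![(t ^ e)⁻¹, Complex.exp (ℓ₁ t)] R = 0) →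
      (∃ R : MvPolynomial (Fin 2) ℚ, R ≠ 0 ∧ ∀ t : ℂ, 0 < ‖t‖ → ‖t‖ < r →
        MvPolynomial.aeval ![(t ^ e)⁻¹, Φ₁ t / t ^ N₀] R = 0) →
      (∃ R : MvPolynomial (Fin 2) ℚ, R ≠ 0 ∧ ∀ t : ℂ, 0 < ‖t‖ → ‖t‖ < r →
        MvPolynomial.aeval ![Φ₁ t / t ^ N₀, Complex.exp (ℓ₀ t)] R = 0) →
      (∃ R : MvPolynomial (Fin 2) ℚ, R ≠ 0 ∧ ∀ t : ℂ, 0 < ‖t‖ → ‖t‖ < r →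
        MvPolynomial.aeval ![Φ₁ t / t ^ N₀, Complex.exp (ℓ₁ t)] R = 0) →
      (∃ R : MvPolynomial (Fin 2) ℚ, R ≠ 0 ∧ ∀ t : ℂ, 0 < ‖t‖ → ‖t‖ < r →
        MvPolynomial.aeval ![Complex.exp (ℓ₀ t), Complex.exp (ℓ₁ t)] R = 0) →
      (∀ n : ℕ, IsAlgebraic ℚ (iteratedDeriv n Φ₁ 0)) →
      IsAlgebraic ℚ (Complex.exp (ℓ₀ 0)) → IsAlgebraic ℚ (Complex.exp (ℓ₁ 0)) →
      (∀ n : ℕ, 0 < n → IsAlgebraic ℚ (iteratedDeriv n ℓ₀ 0)) →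
      (∀ n : ℕ, 0 < n → IsAlgebraic ℚ (iteratedDeriv n ℓ₁ 0)) →
      AnalyticAt ℂ G 0 → (∀ t : ℂ, 0 < ‖t‖ → ‖t‖ < r → Φ₁ t / t ^ N₀ = β * (t ^ e)⁻¹ + G t) →
      IsAlgebraic ℚ β → (∀ n : ℕ, IsAlgebraic ℚ (iteratedDeriv n G 0)) →
      (∀ r' : ℚ, (r' : ℂ) ≠ β) →
      (¬ ∀ᶠ t in 𝓝 (0 : ℂ), ℓ₀ t = ℓ₀ 0 ∧ ℓ₁ t = ℓ₁ 0) →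
      ((∃ q : ℕ, 0 < q ∧ Complex.exp (ℓ₀ 0) ^ q = 1 ∧ Complex.exp (ℓ₁ 0) ^ q = 1) → G 0 ≠ 0) →
      Set.Finite {n : ℕ | LinearIndependent ℚ (x n) ∧ ∃ L : ℤ, A.eval (w n) + g (w n)⁻¹ = L} := by
  intro e N₀ A g ℓu ℓv T ℓ₀ ℓ₁ Φ₁ G ρ r β w x he hρ hr hg hg0 hu hv hT hT0 h₀ h₁ hΦ₁ htr hrat hreal hlac hlink hW' hR₁ hR₂ hR₃ hR₄
    hR₅ hR₆ hΦ₁alg hy₀ hy₁ hℓ₀alg hℓ₁alg hG hlin hβ hGalg hirr hnc htor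
  exact hA ⟨e, N₀, A, g, ℓu, ℓv, T, ℓ₀, ℓ₁, Φ₁, ρ, r, he, hρ, hr, hg, hg0, hu, hv, hT, hT0, h₀, h₁, hΦ₁, htr, hrat, hreal, hlac,
      hlink, hW', hR₁, hR₂, hR₃, hR₄, hR₅, hR₆, hΦ₁alg, hy₀, hy₁, hℓ₀alg, hℓ₁alg⟩ G β hG hlin hβ hGalg hirr hnc htor

/-- `LinearCuspAtom` implies the registered statement of `stub_linearCuspAtom` verbatim. -/
theorem stub_linearCuspAtom_of_named (hA : LinearCuspAtom) :
    ∀ (e N₀ : ℕ) (A : Polynomial ℂ) (g ℓu ℓv T ℓ₀ ℓ₁ Φ₁ G : ℂ → ℂ) (ρ r : ℝ) (β : ℂ) (q : ℕ) (m₀ m₁ : ℤ),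
      let w : ℕ → ℂ := fun n => (((n : ℝ) ^ ((e : ℝ)⁻¹) : ℝ) : ℂ);
      let x : ℕ → Fin 2 → ℂ := fun n =>
        ![2 * ↑π * I * (n : ℂ) + ℓu (w n)⁻¹, 2 * ↑π * I * (A.eval (w n) + g (w n)⁻¹) + ℓv (w n)⁻¹];
      0 < e → 0 < ρ → 0 < r → AnalyticAt ℂ g 0 → g 0 = 0 → AnalyticAt ℂ ℓu 0 → AnalyticAt ℂ ℓv 0 →
      AnalyticAt ℂ T 0 → T 0 = 0 → AnalyticAt ℂ ℓ₀ 0 → AnalyticAt ℂ ℓ₁ 0 → AnalyticAt ℂ Φ₁ 0 →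
      (¬ ∃ P : MvPolynomial (Fin 2) ℂ, P ≠ 0 ∧
          ∀ᶠ z in 𝓝 (0 : ℂ), MvPolynomial.eval ![z, g z] P = 0) →
      (¬ ∃ (q : Polynomial ℚ) (c : ℂ), ∀ N : ℕ,
          A.eval (w N) = (q.map (algebraMap ℚ ℂ)).eval (N : ℂ) + c) →
      ((∀ k : ℕ, (A.coeff k).im = 0) ∧ ∀ᶠ u : ℝ in 𝓝[>] 0, (g (u : ℂ)).im = 0) →
      (∀ ε : ℝ, 0 < ε → ∃ᶠ X : ℕ in atTop,
        (Nat.card {N : ℕ | N ≤ X ∧ ∃ L : ℤ, A.eval (w N) + g (w N)⁻¹ = L} : ℝ) ≤ ε * Real.log X) →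
      (∀ σ : ℂ, 0 < ‖σ‖ → ‖σ‖ < ρ → 0 < ‖T σ‖ ∧ ‖T σ‖ < r ∧
        ((T σ) ^ e)⁻¹ = 2 * ↑π * I * σ⁻¹ ^ e + ℓu σ ∧
        Φ₁ (T σ) / (T σ) ^ N₀ = 2 * ↑π * I * (A.eval σ⁻¹ + g σ) + ℓv σ ∧
        ℓ₀ (T σ) = ℓu σ ∧ ℓ₁ (T σ) = ℓv σ) →
      (∃ W' : Set (Fin 2 ⊕ Fin 2 → ℂ), IsDefinedOver (⊥ : Subfield ℂ) W' ∧ zariskiDim ℂ W' < 2 ∧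
        ∀ t : ℂ, 0 < ‖t‖ → ‖t‖ < r →
          Sum.elim (![(t ^ e)⁻¹, Φ₁ t / t ^ N₀] : Fin 2 → ℂ)
            (![Complex.exp (ℓ₀ t), Complex.exp (ℓ₁ t)] : Fin 2 → ℂ) ∈ W') →
      (∃ R : MvPolynomial (Fin 2) ℚ, R ≠ 0 ∧ ∀ t : ℂ, 0 < ‖t‖ → ‖t‖ < r →
        MvPolynomial.aeval ![(t ^ e)⁻¹, Complex.exp (ℓ₀ t)] R = 0) →
      (∃ R : MvPolynomial (Fin 2) ℚ, R ≠ 0 ∧ ∀ t : ℂ, 0 < ‖t‖ → ‖t‖ < r →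
        MvPolynomial.aeval ![(t ^ e)⁻¹, Complex.exp (ℓ₁ t)] R = 0) →
      (∃ R : MvPolynomial (Fin 2) ℚ, R ≠ 0 ∧ ∀ t : ℂ, 0 < ‖t‖ → ‖t‖ < r →
        MvPolynomial.aeval ![(t ^ e)⁻¹, Φ₁ t / t ^ N₀] R = 0) →
      (∃ R : MvPolynomial (Fin 2) ℚ, R ≠ 0 ∧ ∀ t : ℂ, 0 < ‖t‖ → ‖t‖ < r →
        MvPolynomial.aeval ![Φ₁ t / t ^ N₀, Complex.exp (ℓ₀ t)] R = 0) →
      (∃ R : MvPolynomial (Fin 2) ℚ, R ≠ 0 ∧ ∀ t : ℂ, 0 < ‖t‖ → ‖t‖ < r →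
        MvPolynomial.aeval ![Φ₁ t / t ^ N₀, Complex.exp (ℓ₁ t)] R = 0) →
      (∃ R : MvPolynomial (Fin 2) ℚ, R ≠ 0 ∧ ∀ t : ℂ, 0 < ‖t‖ → ‖t‖ < r →
        MvPolynomial.aeval ![Complex.exp (ℓ₀ t), Complex.exp (ℓ₁ t)] R = 0) →
      (∀ n : ℕ, IsAlgebraic ℚ (iteratedDeriv n Φ₁ 0)) →
      IsAlgebraic ℚ (Complex.exp (ℓ₀ 0)) → IsAlgebraic ℚ (Complex.exp (ℓ₁ 0)) →
      (∀ n : ℕ, 0 < n → IsAlgebraic ℚ (iteratedDeriv n ℓ₀ 0)) →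
      (∀ n : ℕ, 0 < n → IsAlgebraic ℚ (iteratedDeriv n ℓ₁ 0)) →
      AnalyticAt ℂ G 0 → (∀ t : ℂ, 0 < ‖t‖ → ‖t‖ < r → Φ₁ t / t ^ N₀ = β * (t ^ e)⁻¹ + G t) →
      IsAlgebraic ℚ β → (∀ n : ℕ, IsAlgebraic ℚ (iteratedDeriv n G 0)) →
      (∀ r' : ℚ, (r' : ℂ) ≠ β) →
      β.im = 0 → 0 < q → (q : ℂ) * ℓ₀ 0 = 2 * ↑π * I * (m₀ : ℂ) → (q : ℂ) * ℓ₁ 0 = 2 * ↑π * I * (m₁ : ℂ) →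
      G 0 = 0 →
      (¬ ∀ᶠ t in 𝓝 (0 : ℂ), ℓ₀ t = ℓ₀ 0 ∧ ℓ₁ t = ℓ₁ 0) →
      (∃ j : ℕ, j ≤ e ∧ j < e * ((minpoly ℚ β).natDegree - 1) ∧
        (∀ i : ℕ, i < j → iteratedDeriv i (fun t => β * (ℓ₀ t - ℓ₀ 0) - (ℓ₁ t - ℓ₁ 0) + G t) 0 = 0) ∧
        iteratedDeriv j (fun t => β * (ℓ₀ t - ℓ₀ 0) - (ℓ₁ t - ℓ₁ 0) + G t) 0 ≠ 0) →
      Set.Finite {n : ℕ | LinearIndependent ℚ (x n) ∧ ∃ L : ℤ, A.eval (w n) + g (w n)⁻¹ = L} := by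
  intro e N₀ A g ℓu ℓv T ℓ₀ ℓ₁ Φ₁ G ρ r β q m₀ m₁ w x he hρ hr hg hg0 hu hv hT hT0 h₀ h₁ hΦ₁ htr hrat hreal hlac hlink hW' hR₁ hR₂
    hR₃ hR₄ hR₅ hR₆ hΦ₁alg hy₀ hy₁ hℓ₀alg hℓ₁alg hG hlin hβ hGalg hirr hβreal hq hq₀ hq₁ hG0 hnc hord
  exact hA ⟨e, N₀, A, g, ℓu, ℓv, T, ℓ₀, ℓ₁, Φ₁, ρ, r, he, hρ, hr, hg, hg0, hu, hv, hT, hT0, h₀, h₁, hΦ₁, htr, hrat, hreal, hlac,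
      hlink, hW', hR₁, hR₂, hR₃, hR₄, hR₅, hR₆, hΦ₁alg, hy₀, hy₁, hℓ₀alg, hℓ₁alg⟩ G β q m₀ m₁ hG hlin hβ hGalg hirr hβreal hq hq₀ hq₁ hG0 hnc hord

/-! ## The crux implies each named atom (from `RigidCoreSparsityTwoAtomsOfCrux`, p108288) -/

/-- The crux implies A3 as a named statement. -/
theorem wildCuspAtom_of_sparsityTwo' (h : Summit.Schanuel.Schanuel.Theses.RigidCore.SparsityTwo) : WildCuspAtom := by
  intro D hnonlin hnc
  exact wildCuspAtom_of_sparsityTwo h D.e D.N₀ D.A D.g D.ℓu D.ℓv D.T D.ℓ₀ D.ℓ₁ D.Φ₁ D.ρ D.r D.e_pos D.ρ_pos D.r_pos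
    D.g_analytic D.g_zero D.ℓu_analytic D.ℓv_analytic D.T_analytic D.T_zero D.ℓ₀_analytic D.ℓ₁_analytic D.Φ₁_analytic
    D.transcendental D.jet_not_rat D.real D.lacunary D.link D.curve D.rel_x₁_y₁ D.rel_x₁_y₂ D.rel_x₁_x₂ D.rel_x₂_y₁
    D.rel_x₂_y₂ D.rel_y₁_y₂ D.Φ₁_algebraic D.exp_ℓ₀_algebraic D.exp_ℓ₁_algebraic D.ℓ₀_algebraic D.ℓ₁_algebraic hnonlin hnc

/-- The crux implies A2 as a named statement. -/
theorem inhomogeneousCuspAtom_of_sparsityTwo' (h : Summit.Schanuel.Schanuel.Theses.RigidCore.SparsityTwo) :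
    InhomogeneousCuspAtom := by
  intro D G β hG hlin hβ hGalg hirr hnc htor
  exact inhomogeneousCuspAtom_of_sparsityTwo h D.e D.N₀ D.A D.g D.ℓu D.ℓv D.T D.ℓ₀ D.ℓ₁ D.Φ₁ G D.ρ D.r β D.e_pos D.ρ_pos
    D.r_pos D.g_analytic D.g_zero D.ℓu_analytic D.ℓv_analytic D.T_analytic D.T_zero D.ℓ₀_analytic D.ℓ₁_analytic
    D.Φ₁_analytic D.transcendental D.jet_not_rat D.real D.lacunary D.link D.curve D.rel_x₁_y₁ D.rel_x₁_y₂ D.rel_x₁_x₂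
    D.rel_x₂_y₁ D.rel_x₂_y₂ D.rel_y₁_y₂ D.Φ₁_algebraic D.exp_ℓ₀_algebraic D.exp_ℓ₁_algebraic D.ℓ₀_algebraic D.ℓ₁_algebraic
    hG hlin hβ hGalg hirr hnc htor

/-- The crux implies A1 as a named statement. -/
theorem linearCuspAtom_of_sparsityTwo' (h : Summit.Schanuel.Schanuel.Theses.RigidCore.SparsityTwo) : LinearCuspAtom := by
  intro D G β q m₀ m₁ hG hlin hβ hGalg hirr hβreal hq hq₀ hq₁ hG0 hnc hord
  exact linearCuspAtom_of_sparsityTwo h D.e D.N₀ D.A D.g D.ℓu D.ℓv D.T D.ℓ₀ D.ℓ₁ D.Φ₁ G D.ρ D.r β q m₀ m₁ D.e_pos D.ρ_pos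
    D.r_pos D.g_analytic D.g_zero D.ℓu_analytic D.ℓv_analytic D.T_analytic D.T_zero D.ℓ₀_analytic D.ℓ₁_analytic
    D.Φ₁_analytic D.transcendental D.jet_not_rat D.real D.lacunary D.link D.curve D.rel_x₁_y₁ D.rel_x₁_y₂ D.rel_x₁_x₂
    D.rel_x₂_y₁ D.rel_x₂_y₂ D.rel_y₁_y₂ D.Φ₁_algebraic D.exp_ℓ₀_algebraic D.exp_ℓ₁_algebraic D.ℓ₀_algebraic D.ℓ₁_algebraic
    hG hlin hβ hGalg hirr hβreal hq hq₀ hq₁ hG0 hnc hord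


/-! ## The glue and the equivalence -/

/-- **GLUE (registered stub `sparsityTwo_of_namedAtoms`)**: the crux `RigidCore.SparsityTwo` from the three named atoms —
`sparsityTwo_of_atoms_of_parts` fed with the landed parts by name and the bridges. -/
theorem sparsityTwo_of_namedAtoms : WildCuspAtom → InhomogeneousCuspAtom → LinearCuspAtom → Summit.Schanuel.Schanuel.Theses.RigidCore.SparsityTwo :=
  fun hA3 hA2 hA1 =>
    sparsityTwo_of_atoms_of_parts rationalJetShift_eventually_zero rayHits_finite_of_split' stub_cuspEscapeAlg
      stub_deepCuspFinite (stub_wildCuspAtom_of_named hA3) (stub_inhomogeneousCuspAtom_of_named hA2)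
      (stub_linearCuspAtom_of_named hA1)

/-- **EQUIVALENCE (registered stub `sparsityTwo_iff_namedAtoms`)**: with every named part of the line a tree theorem, the crux
is equivalent to the conjunction of its three named atoms. -/
theorem sparsityTwo_iff_namedAtoms : Summit.Schanuel.Schanuel.Theses.RigidCore.SparsityTwo ↔ WildCuspAtom ∧ InhomogeneousCuspAtom ∧ LinearCuspAtom :=
  ⟨fun h => ⟨wildCuspAtom_of_sparsityTwo' h, inhomogeneousCuspAtom_of_sparsityTwo' h, linearCuspAtom_of_sparsityTwo' h⟩,
    fun h => sparsityTwo_of_namedAtoms h.1 h.2.1 h.2.2⟩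

/-- **Upper calibration by name**: each named atom is a theorem of `SchanuelRank 2` (the crux is, by
`sparsity_of_schanuelRank_two` of `TrdegZariskiDim.lean`, and the atoms are instances of the crux). -/
theorem namedAtoms_of_schanuelRank_two (h : SchanuelRank 2) : WildCuspAtom ∧ InhomogeneousCuspAtom ∧ LinearCuspAtom :=
  sparsityTwo_iff_namedAtoms.1 (by intro W hW hd; exact sparsity_of_schanuelRank_two h W hW hd)

end Summit.Schanuel.Schanuel.Cruxes.SparsityTwo.CuspGermSchneiderSparsity
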